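import Literature.NumberTheory.Automorphic.UnitaryLatticeTreeFormTransport          -- ★ p847249 (F0P3a-p01 (g16)): `exists_mem_mapGL_class_iff` (class token under `M ↦ P·M`); brings ★ T1a `UnitaryLatticeTreeDefs` (`mapGL`, `latt`, `pairing`, `IsSelfDualLattice`)
import Literature.NumberTheory.Automorphic.UnitaryLatticeTreeLevelShift            -- ★ (B-p14): `map_sub_one_latt_le_scaleLattice_iff` (the LEVEL token in a basis); brings ★ `UnitaryLatticeTreeDual` (`latt_le_latt_iff`, `scaleLattice_latt`)
import Literature.NumberTheory.Automorphic.UnitaryLatticeTreeStabilizer            -- ★ (B-p14): `mapGL_stdLattice_eq_iff` (`Stab(L₀) = GL_N(𝒪)`)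
import Literature.NumberTheory.Automorphic.UnitaryLatticeTreeSelfDualTransitiveTame  -- ★ (B-p14): `exists_unitary_mapGL_stdLattice_eq_of_isSelfDualLattice_of_v_two` (`U(J₀)` transitive on self-dual vertices, `|2| = 1`)
import Literature.NumberTheory.Automorphic.UnitaryLatticeTreeStarOfInvolution      -- ★ (B-p14): `isSelfDualLattice_stdLattice_three_of_v` (the root is self-dual for `J₀`)
import Literature.NumberTheory.Automorphic.UnitaryLatticeTreeCharpolyCongruence     -- ★ (F0P2-p06): `v_inv_mul_charpoly_coeff_sub_le_one` (`A ≡ B (c) ⇒ χ_A ≡ χ_B (c)`)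
import Literature.NumberTheory.Automorphic.ResiduallyTrivialFixedCosetCount         -- ★ ROW-0 (this seat): `rank_redMat_sub_one_eq_zero_iff_forall_valuation_le`, `redMat_eq_zero_iff_forall_valuation_lt_one`, `rank_eq_zero_iff_eq_zero`; brings `rank_lt_of_isNilpotent`, `mem_fixedBy_quotient_mk_iff`
import Literature.NumberTheory.Automorphic.ResidualMoebiusShiftRank                 -- ★ `pow_card_redMat_eq_zero_of_charpoly_eq` (Cayley–Hamilton on the reduction)
import Literature.NumberTheory.Automorphic.ValuedFieldValuativeRelBridge            -- ★ `v_le_iff_valuation_le`, `isUniformizingElement_of_v_eq`, `mem_glInt_iff_forall_v_le_one` (the `Valued` ↔ `ValuativeRel` bridge)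
import Literature.GroupTheory.SpecificGroups.OrthogonalThreeSymmetricNilpotentOrbitsRankOne   -- ★ p846931 (F0P3-p03 (g14)): `rank_le_one_of_mul_self_eq_zero`, `mul_self_eq_zero_of_rank_le_one_of_isNilpotent`
import HarnessLib

/-!
# Fixed cosets of `U(σ,H) ⧸ U ∩ GL_N(𝒪)` ↔ fixed SELF-DUAL LATTICES, with a predicate, and the dictionary between the two-layer COSET labels (`rank(red u − 1)`,
# `N(u) = red(ϖ⁻¹(u − 1))`, the residual quadratic value `zᵀ(H̄ N(u))z`) and the LATTICE labels (`(γ − 1)M ⊆ ϖ^d M`, `(γ − 1)²M ⊆ ϖ³M`, the class token) at a vertex `M = g·L₀`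

Topic `NumberTheory/Automorphic`; namespace `Literature.NumberTheory.Automorphic.UnitaryLatticeTree`.  THEOREMS ONLY (no definition, no instance, no notation, no named fact, no `sorry`).
Hand F0P3a-p05 (g16), 2026-09-01∕02.  Cell `pub/hodgecm-mathlib`, crux H413 = `stmt-HodgeConjecture-24833`; road «S3-ram» (LEAD F0P3a-plan (g12); owner∕table F0P3a-p06 (g15)); architect
A-p16 (g31) ROAD-P1ram v2 row «A1′ COUNT TRANSPORT» (p05), PART 2 = model cosets → lattices (part 1 = ★ p847240 ∕ ★ p847257: `G′_v`-cosets → model cosets along the frame).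
The LATTICE labels are the (a2) label sheet of F0P3a-p01 (g16) (`TOKENS-a2-LatticeLabels.v1`, d81ac9e9; the spellings of ★ p847249 §5): with `LEV c :≡ (γ − 1)M ⊆ c·M`,
`LEV₂ c :≡ (γ − 1)²M ⊆ c·M`, `CLS c :≡ ∃ y ∈ M, ∃ a, |a| = 1 ∧ |ϖ′·B_H(y, (γ − 1)y) − c·a²| < 1`: bd = `¬ LEV ϖ`, 0 = `LEV ϖ²`, reg = `LEV ϖ ∧ ¬ LEV ϖ² ∧ ¬ LEV₂ ϖ³`,
1□_c = `LEV ϖ ∧ ¬ LEV ϖ² ∧ LEV₂ ϖ³ ∧ CLS c`.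

THE MATHEMATICS ([Kottwitz1986] §3; [Rogawski1990] §4.9 p. 54; [Serre1980Trees] II.1.1; [BruhatTits1972] §10).  Let `K` be a discretely valued field (`Valued K ℤᵐ⁰` with a compatible
`ValuativeRel`, uniformiser `ϖ`), `σ` an isometric involution, `H` a form, `U = U(σ, H) ≤ GL_N(K)`, `K_U = U ∩ GL_N(𝒪)`, `L₀ = 𝒪^N`.  §1: if `L₀` is self-dual for `H` and `U` acts transitively on the
self-dual lattices (★ `UnitaryLatticeTreeSelfDualTransitiveTame` for `H = J₀`, `N = 3`, `|2| = 1`), then `uK_U ↦ u·L₀` is a bijection `Fix_γ(U ⧸ K_U) ≃ {M self-dual : γM = M}` (stabiliser of `L₀`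
is `GL_N(𝒪)`, ★ `mapGL_stdLattice_eq_iff`), and a COSET predicate `P(u⁻¹γu)` matches a LATTICE predicate `Q(u·L₀)` as soon as they agree whenever `u⁻¹γu ∈ GL_N(𝒪)`:
`#{uK_U ∈ Fix_γ : P(u⁻¹γu)} = #{M self-dual : γM = M ∧ Q M}` (`ncard_fixedBy_quotient_sep_eq_ncard_selfDual_fixed_sep`).  §2 (any `g ∈ GL_N(K)`, `u := g⁻¹γg`, `M := g·L₀`): the level token
`A·M ⊆ c·M ⟺ g⁻¹Ag ∈ c·M_N(𝒪)` (★ LevelShift for `A = γ − 1`; here for any `A`, so also for `(γ − 1)²`, where `g⁻¹(γ − 1)²g = (u − 1)²`); hence for `u ∈ GL_N(𝒪)`: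
`rank(red u − 1) = 0 ⟺ (γ − 1)M ⊆ ϖM` (★ ROW-0), and on that locus (`N(u) := red(ϖ⁻¹(u − 1))`, an integral reduction) `rank N(u) = 0 ⟺ (γ − 1)M ⊆ ϖ²M` and `N(u)² = 0 ⟺ (γ − 1)²M ⊆ ϖ³M`.
§3: for a NORMALISED `v`-DEEP `γ` (`γ ≡ 1 (ϖ²)`) both `red(u) − 1` and `N(u)` are nilpotent (`χ_{u−1} = χ_{γ−1} ≡ T^N`, `χ_{ϖ⁻¹(u−1)} = χ_{ϖ⁻¹(γ−1)} ≡ T^N (ϖ)`, Cayley–Hamilton ★), so for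
`N = 3`: `rank N(u) = 2 ⟺ N(u)² ≠ 0`, `rank N(u) = 1 ⟺ N(u)² = 0 ∧ N(u) ≠ 0` (★ p846931).  The class token and the five assembled strata COUNT identities are in the companion file
`UnitaryLatticeTreeFixedCosetStrataCounts` (same hand).  Measure-free, sorry-free bookkeeping; every statement is an equality of `Set.ncard`s or an `iff` of labels.
HONEST LABEL: HC_CM is proved only modulo the 2 remaining named inputs (hLiu418 24832, h413 24833) until rung 0 closes; no books consequence.

## References
* [Kottwitz1986] R. E. Kottwitz, *Base change for unit elements of Hecke algebras*, Compositio Math. 60 (1986): §3 (fixed points of `γ` on the building; the congruence filtration).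
* [Rogawski1990] J. D. Rogawski, *Automorphic Representations of Unitary Groups in Three Variables*, Ann. of Math. Stud. 123 (1990): §4.9 pp. 54–55 (orbital integrals of `1_K` as lattice counts).
* [Serre1980Trees] J.-P. Serre, *Trees* (1980): Ch. II §1.1 (lattices, `GL_N(K) ⧸ GL_N(𝒪)` as the space of lattices, the stabiliser of `𝒪^N`).
* [BruhatTits1972] F. Bruhat, J. Tits, *Groupes réductifs sur un corps local I*, Publ. Math. IHÉS 41 (1972): §10 (vertices of the building of a unitary group as self-dual lattice classes).
-/

set_option autoImplicit false

noncomputable section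

open Matrix ValuativeRel Literature.NumberTheory.Automorphic Literature.NumberTheory.Automorphic.IntegralReduction Literature.GroupTheory.SpecificGroups
open Literature.NumberTheory.Automorphic.HermitianLattice Literature.NumberTheory.Automorphic.UnitaryGroup
open scoped Matrix MatrixGroups WithZero ValuativeRel

namespace Literature.NumberTheory.Automorphic.UnitaryLatticeTree

variable {K : Type*} [Field K] [Valued K ℤᵐ⁰] [ValuativeRel K] [(Valued.v : Valuation K ℤᵐ⁰).Compatible] {N : ℕ}

/-! ## §1 Fixed cosets of `U ⧸ U ∩ GL_N(𝒪)` ↔ fixed self-dual lattices, with a predicate -/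

/-- The stabiliser of the root in `GL_N(K)` is `GL_N(𝒪)`: `k·L₀ = L₀ ↔ k ∈ glInt` (★ `mapGL_stdLattice_eq_iff` in the `ValuativeRel` spelling). [cite: Serre1980Trees, Ch. II §1.1] -/
theorem mapGL_stdLattice_eq_iff_mem_glInt (k : GL (Fin N) K) : mapGL k (stdLattice K N) = (stdLattice K N) ↔ k ∈ glInt N K := by
  rw [mapGL_stdLattice_eq_iff, Literature.NumberTheory.Automorphic.mem_glInt_iff_forall_v_le_one]
  exact Iff.rfl

/-- For `g ∈ U` and `γ ∈ U`: `γ·(g·L₀) = g·L₀ ↔ g⁻¹γg ∈ GL_N(𝒪)`. [cite: Kottwitz1986, §3] [cite: Serre1980Trees, Ch. II §1.1] -/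
theorem mapGL_mapGL_stdLattice_eq_iff_mem_glInt (σ : K →+* K) (H : Matrix (Fin N) (Fin N) K) (γ g : ↥(unitaryGroupOfForm σ H)) :
    mapGL ((γ : ↥(unitaryGroupOfForm σ H)) : GL (Fin N) K) (mapGL ((g : ↥(unitaryGroupOfForm σ H)) : GL (Fin N) K) (stdLattice K N)) = mapGL ((g : ↥(unitaryGroupOfForm σ H)) : GL (Fin N) K) (stdLattice K N) ↔ ((g⁻¹ * γ * g : ↥(unitaryGroupOfForm σ H)) : GL (Fin N) K) ∈ glInt N K := by
  have h : ((γ : ↥(unitaryGroupOfForm σ H)) : GL (Fin N) K) * ((g : ↥(unitaryGroupOfForm σ H)) : GL (Fin N) K) = ((g : ↥(unitaryGroupOfForm σ H)) : GL (Fin N) K) * ((g⁻¹ * γ * g : ↥(unitaryGroupOfForm σ H)) : GL (Fin N) K) := by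
    rw [Subgroup.coe_mul, Subgroup.coe_mul, Subgroup.coe_inv]; group
  rw [← mapGL_mul, h, mapGL_mul, (mapGL_injective ((g : ↥(unitaryGroupOfForm σ H)) : GL (Fin N) K)).eq_iff, mapGL_stdLattice_eq_iff_mem_glInt]

omit [Valued K ℤᵐ⁰] [(Valued.v : Valuation K ℤᵐ⁰).Compatible] in
/-- A fixed coset `q ∈ Fix_γ(U ⧸ K_U)` has `(out q)⁻¹ γ (out q) ∈ GL_N(𝒪)`. [cite: Kottwitz1986, §3] -/
theorem coe_out_inv_mul_mul_out_mem_glInt_of_mem_fixedBy' (σ : K →+* K) (H : Matrix (Fin N) (Fin N) K) (γ : ↥(unitaryGroupOfForm σ H)) {q : (↥(unitaryGroupOfForm σ H) ⧸ ((glInt N K).subgroupOf (unitaryGroupOfForm σ H)))}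
    (hq : q ∈ MulAction.fixedBy (↥(unitaryGroupOfForm σ H) ⧸ ((glInt N K).subgroupOf (unitaryGroupOfForm σ H))) γ) : ((q.out⁻¹ * γ * q.out : ↥(unitaryGroupOfForm σ H)) : GL (Fin N) K) ∈ glInt N K :=
  (Subgroup.mem_subgroupOf).1 ((mem_fixedBy_quotient_mk_iff ((glInt N K).subgroupOf (unitaryGroupOfForm σ H)) γ q.out).1 (by rw [QuotientGroup.out_eq']; exact hq))

/-- **FIXED COSETS ↔ FIXED SELF-DUAL LATTICES, WITH A PREDICATE.**  If the root `L₀ = 𝒪^N` is self-dual for `(σ, ϖ, H)` and `U = U(σ, H)` acts transitively on the self-dual lattices, then for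
every `γ ∈ U`, every coset predicate `P` and lattice predicate `Q` that agree at `u⁻¹γu ∈ GL_N(𝒪)` ∕ `u·L₀`:
`#{uK_U ∈ Fix_γ(U ⧸ K_U) : P(u⁻¹γu)} = #{M : M self-dual, γM = M, Q M}` (the map `uK_U ↦ u·L₀`; `K_U = U ∩ GL_N(𝒪) = Stab_U(L₀)`).
[cite: Kottwitz1986, §3] [cite: Rogawski1990, §4.9 p. 54] [cite: Serre1980Trees, Ch. II §1.1] [cite: BruhatTits1972, §10] -/
theorem ncard_fixedBy_quotient_sep_eq_ncard_selfDual_fixed_sep (σ : K →+* K) (ϖ : K) (H : Matrix (Fin N) (Fin N) K)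
    (hL₀ : IsSelfDualLattice σ ϖ H (stdLattice K N))
    (htrans : ∀ M : Submodule (Valued.integer K) (Fin N → K), IsSelfDualLattice σ ϖ H M → ∃ u : ↥(unitaryGroupOfForm σ H), M = mapGL ((u : ↥(unitaryGroupOfForm σ H)) : GL (Fin N) K) (stdLattice K N))
    (γ : ↥(unitaryGroupOfForm σ H)) (P : ↥(unitaryGroupOfForm σ H) → Prop) (Q : Submodule (Valued.integer K) (Fin N → K) → Prop)
    (hPQ : ∀ g : ↥(unitaryGroupOfForm σ H), ((g⁻¹ * γ * g : ↥(unitaryGroupOfForm σ H)) : GL (Fin N) K) ∈ glInt N K → (P (g⁻¹ * γ * g) ↔ Q (mapGL ((g : ↥(unitaryGroupOfForm σ H)) : GL (Fin N) K) (stdLattice K N)))) :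
    {q : (↥(unitaryGroupOfForm σ H) ⧸ ((glInt N K).subgroupOf (unitaryGroupOfForm σ H))) | q ∈ MulAction.fixedBy (↥(unitaryGroupOfForm σ H) ⧸ ((glInt N K).subgroupOf (unitaryGroupOfForm σ H))) γ ∧ P (q.out⁻¹ * γ * q.out)}.ncard =
      {M : Submodule (Valued.integer K) (Fin N → K) | IsSelfDualLattice σ ϖ H M ∧ mapGL ((γ : ↥(unitaryGroupOfForm σ H)) : GL (Fin N) K) M = M ∧ Q M}.ncard := by
  classical
  -- the map `q ↦ (out q)·L₀` and its value on `uK_U`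
  have hΦmk : ∀ u : ↥(unitaryGroupOfForm σ H), mapGL (((((u : ↥(unitaryGroupOfForm σ H)) : (↥(unitaryGroupOfForm σ H) ⧸ ((glInt N K).subgroupOf (unitaryGroupOfForm σ H)))).out) : ↥(unitaryGroupOfForm σ H)) : GL (Fin N) K) (stdLattice K N) = mapGL ((u : ↥(unitaryGroupOfForm σ H)) : GL (Fin N) K) (stdLattice K N) := by
    intro u
    obtain ⟨k, hk⟩ := QuotientGroup.mk_out_eq_mul ((glInt N K).subgroupOf (unitaryGroupOfForm σ H)) u
    rw [hk, Subgroup.coe_mul, mapGL_mul, (mapGL_stdLattice_eq_iff_mem_glInt _).2 ((Subgroup.mem_subgroupOf).1 k.2)]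
  have hinj : Set.InjOn (fun q : (↥(unitaryGroupOfForm σ H) ⧸ ((glInt N K).subgroupOf (unitaryGroupOfForm σ H))) => mapGL ((q.out : ↥(unitaryGroupOfForm σ H)) : GL (Fin N) K) (stdLattice K N)) {q : (↥(unitaryGroupOfForm σ H) ⧸ ((glInt N K).subgroupOf (unitaryGroupOfForm σ H))) | q ∈ MulAction.fixedBy (↥(unitaryGroupOfForm σ H) ⧸ ((glInt N K).subgroupOf (unitaryGroupOfForm σ H))) γ ∧ P (q.out⁻¹ * γ * q.out)} := by
    intro q _ q' _ h
    have h' : mapGL ((q'.out⁻¹ * q.out : ↥(unitaryGroupOfForm σ H)) : GL (Fin N) K) (stdLattice K N) = (stdLattice K N) := by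
      rw [Subgroup.coe_mul, Subgroup.coe_inv, mapGL_mul]
      have h1 : mapGL ((q.out : ↥(unitaryGroupOfForm σ H)) : GL (Fin N) K) (stdLattice K N) = mapGL ((q'.out : ↥(unitaryGroupOfForm σ H)) : GL (Fin N) K) (stdLattice K N) := h
      rw [h1, ← mapGL_mul, inv_mul_cancel, mapGL_one]
    rw [← QuotientGroup.out_eq' q, ← QuotientGroup.out_eq' q']
    exact (QuotientGroup.eq.2 ((Subgroup.mem_subgroupOf).2 ((mapGL_stdLattice_eq_iff_mem_glInt _).1 h'))).symm
  rw [← hinj.ncard_image]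
  congr 1
  ext M
  simp only [Set.mem_image, Set.mem_setOf_eq]
  constructor
  · rintro ⟨q, ⟨hq, hP⟩, rfl⟩
    have hmem := coe_out_inv_mul_mul_out_mem_glInt_of_mem_fixedBy' σ H γ hq
    exact ⟨(isVertexLattice_mapGL_iff σ ϖ H q.out (stdLattice K N)).2 hL₀, (mapGL_mapGL_stdLattice_eq_iff_mem_glInt σ H γ q.out).2 hmem, (hPQ _ hmem).1 hP⟩
  · rintro ⟨hsd, hfix, hQ⟩
    obtain ⟨u, rfl⟩ := htrans M hsd
    have hmem : ((u⁻¹ * γ * u : ↥(unitaryGroupOfForm σ H)) : GL (Fin N) K) ∈ glInt N K := (mapGL_mapGL_stdLattice_eq_iff_mem_glInt σ H γ u).1 hfix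
    have hq : ((u : ↥(unitaryGroupOfForm σ H)) : (↥(unitaryGroupOfForm σ H) ⧸ ((glInt N K).subgroupOf (unitaryGroupOfForm σ H)))) ∈ MulAction.fixedBy (↥(unitaryGroupOfForm σ H) ⧸ ((glInt N K).subgroupOf (unitaryGroupOfForm σ H))) γ := (mem_fixedBy_quotient_mk_iff ((glInt N K).subgroupOf (unitaryGroupOfForm σ H)) γ u).2 ((Subgroup.mem_subgroupOf).2 hmem)
    refine ⟨((u : ↥(unitaryGroupOfForm σ H)) : (↥(unitaryGroupOfForm σ H) ⧸ ((glInt N K).subgroupOf (unitaryGroupOfForm σ H)))), ⟨hq, ?_⟩, hΦmk u⟩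
    rw [hPQ _ (coe_out_inv_mul_mul_out_mem_glInt_of_mem_fixedBy' σ H γ hq), hΦmk u]
    exact hQ

/-- **THE SAME AT `J₀ = antidiag(1,…,1)`, `N = 3`, `|2| = 1`**: the two hypotheses of the master hold (★ `isSelfDualLattice_stdLattice_three_of_v`, ★
`exists_unitary_mapGL_stdLattice_eq_of_isSelfDualLattice_of_v_two`), so for `U = U(σ, J₀)(K)`, any isometric involution `σ`:
`#{uK_U ∈ Fix_γ(U ⧸ K_U) : P(u⁻¹γu)} = #{M : M self-dual for J₀, γM = M, Q M}`. [cite: Kottwitz1986, §3] [cite: Rogawski1990, §4.9 p. 54] [cite: BruhatTits1972, §10] -/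
theorem ncard_fixedBy_quotient_sep_eq_ncard_selfDual_fixed_sep_antidiagonal {σ : K →+* K} (hσ : ∀ a, σ (σ a) = a) (hvσ : ∀ a, Valued.v (σ a) = Valued.v a)
    {ϖ : K} (hϖ : Valued.v ϖ = WithZero.exp (-1 : ℤ)) (h2 : Valued.v (2 : K) = 1)
    (γ : ↥(unitaryGroupOfForm σ ((StdForm.antidiagonal 3).over K))) (P : ↥(unitaryGroupOfForm σ ((StdForm.antidiagonal 3).over K)) → Prop) (Q : Submodule (Valued.integer K) (Fin 3 → K) → Prop)
    (hPQ : ∀ g : ↥(unitaryGroupOfForm σ ((StdForm.antidiagonal 3).over K)), ((g⁻¹ * γ * g : ↥(unitaryGroupOfForm σ ((StdForm.antidiagonal 3).over K))) : GL (Fin 3) K) ∈ glInt 3 K →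
      (P (g⁻¹ * γ * g) ↔ Q (mapGL ((g : ↥(unitaryGroupOfForm σ ((StdForm.antidiagonal 3).over K))) : GL (Fin 3) K) (stdLattice K 3)))) :
    {q : ↥(unitaryGroupOfForm σ ((StdForm.antidiagonal 3).over K)) ⧸ (glInt 3 K).subgroupOf (unitaryGroupOfForm σ ((StdForm.antidiagonal 3).over K)) |
        q ∈ MulAction.fixedBy (↥(unitaryGroupOfForm σ ((StdForm.antidiagonal 3).over K)) ⧸ (glInt 3 K).subgroupOf (unitaryGroupOfForm σ ((StdForm.antidiagonal 3).over K))) γ ∧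
          P (q.out⁻¹ * γ * q.out)}.ncard =
      {M : Submodule (Valued.integer K) (Fin 3 → K) | IsSelfDualLattice σ ϖ ((StdForm.antidiagonal 3).over K) M ∧
        mapGL ((γ : ↥(unitaryGroupOfForm σ ((StdForm.antidiagonal 3).over K))) : GL (Fin 3) K) M = M ∧ Q M}.ncard :=
  ncard_fixedBy_quotient_sep_eq_ncard_selfDual_fixed_sep σ ϖ _ (isSelfDualLattice_stdLattice_three_of_v hϖ)
    (fun _ hM => exists_unitary_mapGL_stdLattice_eq_of_isSelfDualLattice_of_v_two hσ hvσ hϖ h2 hM) γ P Q hPQ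

/-! ## §2 The level tokens at a vertex `g·L₀` are valuation bounds on `g⁻¹γg` -/

omit [ValuativeRel K] [(Valued.v : Valuation K ℤᵐ⁰).Compatible] in
/-- **THE LEVEL TOKEN OF A GENERAL OPERATOR, IN A BASIS**: `A·(g·L₀) ⊆ c·(g·L₀) ↔ |(g⁻¹ A g)_{ik}| ≤ |c|` for all `i, k` (`c ≠ 0`; ★ `map_sub_one_latt_le_scaleLattice_iff` is the case
`A = γ − 1`). [cite: Kottwitz1986, §3] [cite: Serre1980Trees, Ch. II §1.1] -/
theorem map_toLin'_mapGL_stdLattice_le_scaleLattice_iff {c : K} (hc : c ≠ 0) (A : Matrix (Fin N) (Fin N) K) (g : GL (Fin N) K) :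
    (mapGL g (stdLattice K N)).map ((Matrix.toLin' A).restrictScalars (Valued.integer K)) ≤ scaleLattice c (mapGL g (stdLattice K N)) ↔
      ∀ i k, Valued.v (((g : Matrix (Fin N) (Fin N) K)⁻¹ * A * (g : Matrix (Fin N) (Fin N) K)) i k) ≤ Valued.v c := by
  have hg : IsUnit (g : Matrix (Fin N) (Fin N) K).det := Matrix.isUnits_det_units g
  have hcg : IsUnit (c • (g : Matrix (Fin N) (Fin N) K)).det := by
    rw [Matrix.det_smul]; exact (hc.isUnit.pow _).mul hg
  change (latt (g : Matrix (Fin N) (Fin N) K)).map _ ≤ scaleLattice c (latt (g : Matrix (Fin N) (Fin N) K)) ↔ _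
  rw [← latt_mul, scaleLattice_latt, latt_le_latt_iff hcg]
  have hinv : (c • (g : Matrix (Fin N) (Fin N) K))⁻¹ = c⁻¹ • (g : Matrix (Fin N) (Fin N) K)⁻¹ :=
    Matrix.inv_eq_left_inv (by rw [Matrix.smul_mul, Matrix.mul_smul, smul_smul, inv_mul_cancel₀ hc, one_smul, Matrix.nonsing_inv_mul _ hg])
  rw [hinv, Matrix.smul_mul, ← Matrix.mul_assoc]
  have key : ∀ x : K, Valued.v (c⁻¹ * x) ≤ 1 ↔ Valued.v x ≤ Valued.v c := fun x => by
    have hc' : Valued.v c ≠ 0 := (Valuation.ne_zero_iff _).2 hc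
    rw [map_mul, map_inv₀, ← div_eq_inv_mul, div_le_one₀ (zero_lt_iff.2 hc')]
  unfold IsIntMatrix
  refine forall_congr' fun i => forall_congr' fun k => ?_
  rw [Matrix.smul_apply, smul_eq_mul]
  exact key _

omit [Valued K ℤᵐ⁰] [ValuativeRel K] [(Valued.v : Valuation K ℤᵐ⁰).Compatible] in
/-- `g⁻¹γg − 1 = g⁻¹ (γ − 1) g`. [cite: Kottwitz1986, §3] -/
theorem units_coe_inv_mul_mul_sub_one_eq_conj (γ g : GL (Fin N) K) :
    (((g⁻¹ * γ * g : GL (Fin N) K)) : Matrix (Fin N) (Fin N) K) - 1 = (g : Matrix (Fin N) (Fin N) K)⁻¹ * ((γ : Matrix (Fin N) (Fin N) K) - 1) * (g : Matrix (Fin N) (Fin N) K) := by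
  rw [Units.val_mul, Units.val_mul, Matrix.coe_units_inv, Matrix.mul_sub, Matrix.sub_mul, Matrix.mul_one, Matrix.nonsing_inv_mul _ (Matrix.isUnits_det_units g)]

omit [Valued K ℤᵐ⁰] [ValuativeRel K] [(Valued.v : Valuation K ℤᵐ⁰).Compatible] in
/-- `g⁻¹ (γ − 1)² g = (g⁻¹γg − 1)²`. [cite: Kottwitz1986, §3] -/
theorem coe_inv_mul_sub_one_sq_mul (γ g : GL (Fin N) K) :
    (g : Matrix (Fin N) (Fin N) K)⁻¹ * ((γ : Matrix (Fin N) (Fin N) K) - 1) ^ 2 * (g : Matrix (Fin N) (Fin N) K) = ((((g⁻¹ * γ * g : GL (Fin N) K)) : Matrix (Fin N) (Fin N) K) - 1) ^ 2 := by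
  rw [units_coe_inv_mul_mul_sub_one_eq_conj, pow_two, pow_two]
  simp only [Matrix.mul_assoc]
  rw [Matrix.mul_nonsing_inv_cancel_left _ _ (Matrix.isUnits_det_units g)]

omit [Valued K ℤᵐ⁰] [ValuativeRel K] [(Valued.v : Valuation K ℤᵐ⁰).Compatible] in
/-- `ϖ⁻¹(g⁻¹γg − 1) = g⁻¹ · ϖ⁻¹(γ − 1) · g`. [cite: Kottwitz1986, §3] -/
theorem inv_smul_units_coe_inv_mul_mul_sub_one_eq_conj (ϖ : K) (γ g : GL (Fin N) K) :
    ϖ⁻¹ • ((((g⁻¹ * γ * g : GL (Fin N) K)) : Matrix (Fin N) (Fin N) K) - 1) =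
      (g : Matrix (Fin N) (Fin N) K)⁻¹ * (ϖ⁻¹ • ((γ : Matrix (Fin N) (Fin N) K) - 1)) * (g : Matrix (Fin N) (Fin N) K) := by
  rw [units_coe_inv_mul_mul_sub_one_eq_conj, Matrix.mul_smul, Matrix.smul_mul]

/-- In the `ValuativeRel` currency, `|x| < 1 ↔ |x| ≤ |ϖ|` for a uniformiser `ϖ`. [cite: Serre1980Trees, Ch. II §1.1] -/
theorem valuation_lt_one_iff_le_valuation_of_v_eq {ϖ : K} (hϖ : Valued.v ϖ = WithZero.exp (-1 : ℤ)) (x : K) :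
    valuation K x < 1 ↔ valuation K x ≤ valuation K ϖ := by
  have hϖu : IsUniformizingElement ϖ := isUniformizingElement_of_v_eq hϖ
  constructor
  · intro hx
    obtain ⟨y, hy, rfl⟩ := hϖu.exists_eq_mul ((Valuation.mem_integer_iff _ _).2 hx.le) hx
    rw [map_mul]
    exact mul_le_of_le_one_right' ((Valuation.mem_integer_iff _ _).1 hy)
  · intro hx
    exact hx.trans_lt hϖu.valuation_lt_one

/-- `|x| < 1 ↔ |x| ≤ |ϖ|` (`Valued` currency). [cite: Serre1980Trees, Ch. II §1.1] -/
theorem v_lt_one_iff_le_v_of_v_eq {ϖ : K} (hϖ : Valued.v ϖ = WithZero.exp (-1 : ℤ)) (x : K) :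
    Valued.v x < 1 ↔ Valued.v x ≤ Valued.v ϖ := by
  rw [v_lt_one_iff_valuation_lt_one, valuation_lt_one_iff_le_valuation_of_v_eq hϖ, v_le_iff_valuation_le]

omit [ValuativeRel K] [(Valued.v : Valuation K ℤᵐ⁰).Compatible] in
/-- `|ϖ⁻¹ x| ≤ |ϖ| ↔ |x| ≤ |ϖ²|`. [cite: Serre1980Trees, Ch. II §1.1] -/
theorem v_inv_mul_le_v_iff_le_v_sq {ϖ : K} (hϖ0 : ϖ ≠ 0) (x : K) :
    Valued.v (ϖ⁻¹ * x) ≤ Valued.v ϖ ↔ Valued.v x ≤ Valued.v (ϖ ^ 2) := by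
  have hv0 : Valued.v ϖ ≠ 0 := (Valuation.ne_zero_iff _).2 hϖ0
  rw [map_mul, map_inv₀, map_pow, pow_two]
  constructor
  · intro h
    have h' := mul_le_mul_right h (Valued.v ϖ)
    rwa [mul_inv_cancel_left₀ hv0] at h'
  · intro h
    have h' := mul_le_mul_right h (Valued.v ϖ)⁻¹
    rwa [inv_mul_cancel_left₀ hv0] at h'

omit [ValuativeRel K] [(Valued.v : Valuation K ℤᵐ⁰).Compatible] in
/-- `|ϖ² x| ≤ |ϖ³| ↔ |x| ≤ |ϖ|`. [cite: Serre1980Trees, Ch. II §1.1] -/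
theorem v_sq_mul_le_v_cube_iff {ϖ : K} (hϖ0 : ϖ ≠ 0) (x : K) :
    Valued.v (ϖ ^ 2 * x) ≤ Valued.v (ϖ ^ 3) ↔ Valued.v x ≤ Valued.v ϖ := by
  have hv0 : Valued.v (ϖ ^ 2) ≠ 0 := (Valuation.ne_zero_iff _).2 (pow_ne_zero 2 hϖ0)
  rw [map_mul, pow_succ ϖ 2, map_mul]
  constructor
  · intro h
    have h' := mul_le_mul_right h (Valued.v (ϖ ^ 2))⁻¹
    rwa [inv_mul_cancel_left₀ hv0, inv_mul_cancel_left₀ hv0] at h'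
  · intro h
    exact mul_le_mul_right h _

/-- An element of `GL_N(𝒪)` with `rank(red u − 1) = 0` has `ϖ⁻¹(u − 1)` integral (★ ROW-0). [cite: Kottwitz1986, §3] -/
theorem valBound_inv_smul_sub_one_of_rank_eq_zero {ϖ : K} (hϖ : Valued.v ϖ = WithZero.exp (-1 : ℤ)) {u : GL (Fin N) K} (hu : u ∈ glInt N K)
    (hr0 : (redMat (u : Matrix (Fin N) (Fin N) K) - 1).rank = 0) : ValBound 1 (ϖ⁻¹ • ((u : Matrix (Fin N) (Fin N) K) - 1)) := by
  have hle := (rank_redMat_sub_one_eq_zero_iff_forall_valuation_le (isUniformizingElement_of_v_eq hϖ) hu).1 hr0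
  have hϖ0 : ϖ ≠ 0 := (isUniformizingElement_of_v_eq hϖ).ne_zero
  have hvϖ : valuation K ϖ ≠ 0 := (Valuation.ne_zero_iff _).2 hϖ0
  intro i j
  rw [Matrix.smul_apply, smul_eq_mul, map_mul, map_inv₀]
  calc (valuation K ϖ)⁻¹ * valuation K (((u : Matrix (Fin N) (Fin N) K) - 1) i j) ≤ (valuation K ϖ)⁻¹ * valuation K ϖ := by gcongr; exact hle i j
    _ = 1 := inv_mul_cancel₀ hvϖ

/-- **ROW 0 AS A LATTICE TOKEN: `rank(red u − 1) = 0 ⟺ (γ − 1)·(g·L₀) ⊆ ϖ·(g·L₀)`** for `u = g⁻¹γg ∈ GL_N(𝒪)` (★ ROW-0 read through ★ LevelShift).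
[cite: Kottwitz1986, §3] [cite: Serre1980Trees, Ch. II §1.1–1.2] -/
theorem rank_redMat_sub_one_eq_zero_iff_map_sub_one_le {ϖ : K} (hϖ : Valued.v ϖ = WithZero.exp (-1 : ℤ)) {γ g : GL (Fin N) K} (hu : g⁻¹ * γ * g ∈ glInt N K) :
    (redMat (((g⁻¹ * γ * g : GL (Fin N) K)) : Matrix (Fin N) (Fin N) K) - 1).rank = 0 ↔
      (mapGL g (stdLattice K N)).map ((Matrix.toLin' ((γ : Matrix (Fin N) (Fin N) K) - 1)).restrictScalars (Valued.integer K)) ≤ scaleLattice ϖ (mapGL g (stdLattice K N)) := by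
  have hϖ0 : ϖ ≠ 0 := (isUniformizingElement_of_v_eq hϖ).ne_zero
  rw [rank_redMat_sub_one_eq_zero_iff_forall_valuation_le (isUniformizingElement_of_v_eq hϖ) hu]
  change _ ↔ (latt (g : Matrix (Fin N) (Fin N) K)).map _ ≤ scaleLattice ϖ (latt (g : Matrix (Fin N) (Fin N) K))
  rw [map_sub_one_latt_le_scaleLattice_iff hϖ0 γ g]
  exact forall_congr' fun i => forall_congr' fun k => (v_le_iff_valuation_le _ _).symm

/-- **THE DEEP TOKEN: on ROW 0, `rank N(u) = 0 ⟺ (γ − 1)·(g·L₀) ⊆ ϖ²·(g·L₀)`** (`N(u) = red(ϖ⁻¹(u − 1))`, `u = g⁻¹γg ∈ GL_N(𝒪)`).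
[cite: Kottwitz1986, §3] [cite: Rogawski1990, §4.9 p. 55] -/
theorem rank_redMat_inv_smul_sub_one_eq_zero_iff_map_sub_one_le_sq {ϖ : K} (hϖ : Valued.v ϖ = WithZero.exp (-1 : ℤ)) {γ g : GL (Fin N) K}
    (hu : g⁻¹ * γ * g ∈ glInt N K) (hr0 : (redMat (((g⁻¹ * γ * g : GL (Fin N) K)) : Matrix (Fin N) (Fin N) K) - 1).rank = 0) :
    (redMat (ϖ⁻¹ • ((((g⁻¹ * γ * g : GL (Fin N) K)) : Matrix (Fin N) (Fin N) K) - 1))).rank = 0 ↔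
      (mapGL g (stdLattice K N)).map ((Matrix.toLin' ((γ : Matrix (Fin N) (Fin N) K) - 1)).restrictScalars (Valued.integer K)) ≤
        scaleLattice (ϖ ^ 2) (mapGL g (stdLattice K N)) := by
  have hϖ0 : ϖ ≠ 0 := (isUniformizingElement_of_v_eq hϖ).ne_zero
  have hNint := valBound_inv_smul_sub_one_of_rank_eq_zero hϖ hu hr0
  rw [rank_eq_zero_iff_eq_zero, redMat_eq_zero_iff_forall_valuation_lt_one hNint]
  change _ ↔ (latt (g : Matrix (Fin N) (Fin N) K)).map _ ≤ scaleLattice (ϖ ^ 2) (latt (g : Matrix (Fin N) (Fin N) K))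
  rw [map_sub_one_latt_le_scaleLattice_iff (pow_ne_zero 2 hϖ0) γ g]
  refine forall_congr' fun i => forall_congr' fun k => ?_
  rw [valuation_lt_one_iff_le_valuation_of_v_eq hϖ, ← v_le_iff_valuation_le, Matrix.smul_apply, smul_eq_mul, v_inv_mul_le_v_iff_le_v_sq hϖ0]

/-- **THE SQUARE TOKEN: on ROW 0, `N(u)² = 0 ⟺ (γ − 1)²·(g·L₀) ⊆ ϖ³·(g·L₀)`** (`(u − 1)² = ϖ²·(ϖ⁻¹(u − 1))²`, reduction is multiplicative on integral matrices).
[cite: Kottwitz1986, §3] [cite: Rogawski1990, §4.9 p. 55] -/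
theorem redMat_inv_smul_sub_one_mul_self_eq_zero_iff_map_sub_one_sq_le {ϖ : K} (hϖ : Valued.v ϖ = WithZero.exp (-1 : ℤ)) {γ g : GL (Fin N) K}
    (hu : g⁻¹ * γ * g ∈ glInt N K) (hr0 : (redMat (((g⁻¹ * γ * g : GL (Fin N) K)) : Matrix (Fin N) (Fin N) K) - 1).rank = 0) :
    redMat (ϖ⁻¹ • ((((g⁻¹ * γ * g : GL (Fin N) K)) : Matrix (Fin N) (Fin N) K) - 1)) * redMat (ϖ⁻¹ • ((((g⁻¹ * γ * g : GL (Fin N) K)) : Matrix (Fin N) (Fin N) K) - 1)) = 0 ↔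
      (mapGL g (stdLattice K N)).map ((Matrix.toLin' (((γ : Matrix (Fin N) (Fin N) K) - 1) ^ 2)).restrictScalars (Valued.integer K)) ≤
        scaleLattice (ϖ ^ 3) (mapGL g (stdLattice K N)) := by
  have hϖ0 : ϖ ≠ 0 := (isUniformizingElement_of_v_eq hϖ).ne_zero
  have hNint := valBound_inv_smul_sub_one_of_rank_eq_zero hϖ hu hr0
  have hNN : ValBound 1 (ϖ⁻¹ • ((((g⁻¹ * γ * g : GL (Fin N) K)) : Matrix (Fin N) (Fin N) K) - 1) * (ϖ⁻¹ • ((((g⁻¹ * γ * g : GL (Fin N) K)) : Matrix (Fin N) (Fin N) K) - 1))) := by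
    have h := hNint.mul hNint; rwa [one_mul] at h
  rw [← redMat_mul hNint hNint, redMat_eq_zero_iff_forall_valuation_lt_one hNN, map_toLin'_mapGL_stdLattice_le_scaleLattice_iff (pow_ne_zero 3 hϖ0) _ g,
    coe_inv_mul_sub_one_sq_mul]
  have hN : ((((g⁻¹ * γ * g : GL (Fin N) K)) : Matrix (Fin N) (Fin N) K) - 1) = ϖ • (ϖ⁻¹ • ((((g⁻¹ * γ * g : GL (Fin N) K)) : Matrix (Fin N) (Fin N) K) - 1)) := by
    rw [smul_smul, mul_inv_cancel₀ hϖ0, one_smul]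
  have hsq : ((((g⁻¹ * γ * g : GL (Fin N) K)) : Matrix (Fin N) (Fin N) K) - 1) ^ 2 =
      ϖ ^ 2 • (ϖ⁻¹ • ((((g⁻¹ * γ * g : GL (Fin N) K)) : Matrix (Fin N) (Fin N) K) - 1) * (ϖ⁻¹ • ((((g⁻¹ * γ * g : GL (Fin N) K)) : Matrix (Fin N) (Fin N) K) - 1))) := by
    conv_lhs => rw [pow_two, hN]
    rw [Matrix.smul_mul, Matrix.mul_smul, smul_smul, ← pow_two]
  rw [hsq]
  refine forall_congr' fun i => forall_congr' fun k => ?_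
  rw [valuation_lt_one_iff_le_valuation_of_v_eq hϖ, ← v_le_iff_valuation_le, Matrix.smul_apply, smul_eq_mul, v_sq_mul_le_v_cube_iff hϖ0]

/-! ## §3 For a normalised `v`-deep `γ` (`γ ≡ 1 (ϖ²)`), `red(g⁻¹γg) − 1` and `N(g⁻¹γg)` are nilpotent; ranks of nilpotent `3 × 3` matrices -/

/-- A normalised `v`-deep `γ` (`|ϖ⁻²(γ − 1)_{ab}| ≤ 1`) has `|(γ − 1)_{ab}| ≤ |ϖ|²` and `|ϖ⁻¹(γ − 1)_{ab}| ≤ |ϖ|`. [cite: Kottwitz1986, §3] -/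
theorem v_sub_one_le_of_vDeep {ϖ : K} (hϖ : Valued.v ϖ = WithZero.exp (-1 : ℤ)) {γ : GL (Fin N) K}
    (hdeep : ∀ a b, Valued.v (ϖ⁻¹ * (ϖ⁻¹ * ((γ : Matrix (Fin N) (Fin N) K) - 1) a b)) ≤ 1) (a b : Fin N) :
    Valued.v ((ϖ⁻¹ • ((γ : Matrix (Fin N) (Fin N) K) - 1)) a b) ≤ Valued.v ϖ ∧ Valued.v (((γ : Matrix (Fin N) (Fin N) K) - 1) a b) ≤ Valued.v ϖ * Valued.v ϖ := by
  have hϖ0 : ϖ ≠ 0 := (isUniformizingElement_of_v_eq hϖ).ne_zero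
  have hv0 : Valued.v ϖ ≠ 0 := (Valuation.ne_zero_iff _).2 hϖ0
  have h1 : Valued.v (ϖ⁻¹ * ((γ : Matrix (Fin N) (Fin N) K) - 1) a b) ≤ Valued.v ϖ := by
    have h := mul_le_mul_right (hdeep a b) (Valued.v ϖ)
    rwa [mul_one, ← map_mul, mul_inv_cancel_left₀ hϖ0] at h
  refine ⟨by rwa [Matrix.smul_apply, smul_eq_mul], ?_⟩
  have h := mul_le_mul_right h1 (Valued.v ϖ)
  rwa [← map_mul, mul_inv_cancel_left₀ hϖ0] at h

/-- **`red(u) − 1` IS NILPOTENT** for `u = g⁻¹γg ∈ GL_N(𝒪)`, `γ` normalised `v`-deep: `χ_{u − 1} = χ_{γ − 1} ≡ T^N (ϖ)`, so `(red u − 1)^N = 0` (Cayley–Hamilton ★).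
[cite: Kottwitz1986, §3] [cite: Serre1980Trees, Ch. II §1.1–1.2] -/
theorem redMat_sub_one_pow_eq_zero_of_vDeep {ϖ : K} (hϖ : Valued.v ϖ = WithZero.exp (-1 : ℤ)) {γ g : GL (Fin N) K}
    (hdeep : ∀ a b, Valued.v (ϖ⁻¹ * (ϖ⁻¹ * ((γ : Matrix (Fin N) (Fin N) K) - 1) a b)) ≤ 1) (hu : g⁻¹ * γ * g ∈ glInt N K) :
    (redMat (((g⁻¹ * γ * g : GL (Fin N) K)) : Matrix (Fin N) (Fin N) K) - 1) ^ N = 0 := by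
  have hϖ1 : Valued.v ϖ < 1 := by rw [hϖ, ← WithZero.exp_zero]; exact WithZero.exp_lt_exp.2 (by norm_num)
  have hϖϖ : Valued.v ϖ * Valued.v ϖ < 1 := by
    calc Valued.v ϖ * Valued.v ϖ ≤ Valued.v ϖ * 1 := mul_le_mul_right hϖ1.le _
      _ < 1 := by rw [mul_one]; exact hϖ1
  have huv : ValBound 1 (((g⁻¹ * γ * g : GL (Fin N) K)) : Matrix (Fin N) (Fin N) K) := valBound_one_of_mem_glInt hu
  have hA : ValBound 1 ((((g⁻¹ * γ * g : GL (Fin N) K)) : Matrix (Fin N) (Fin N) K) - 1) := huv.sub valBound_one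
  have hWv : ∀ a b, Valued.v (((γ : Matrix (Fin N) (Fin N) K) - 1) a b) < 1 := fun a b => ((v_sub_one_le_of_vDeep hϖ hdeep a b).2).trans_lt hϖϖ
  have hW : ValBound 1 ((γ : Matrix (Fin N) (Fin N) K) - 1) := fun a b => by
    have h := (v_le_one_iff_valuation_le_one _).1 (hWv a b).le; exact h
  have hWlt : ∀ a b, valuation K (((γ : Matrix (Fin N) (Fin N) K) - 1) a b) < 1 := fun a b => (v_lt_one_iff_valuation_lt_one _).1 (hWv a b)
  have hchar : ((((g⁻¹ * γ * g : GL (Fin N) K)) : Matrix (Fin N) (Fin N) K) - 1).charpoly = ((γ : Matrix (Fin N) (Fin N) K) - 1).charpoly := by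
    rw [units_coe_inv_mul_mul_sub_one_eq_conj]; exact Matrix.charpoly_units_conj' g _
  have h := pow_card_redMat_eq_zero_of_charpoly_eq hA hW hWlt hchar
  rwa [redMat_sub huv valBound_one, redMat_one] at h

/-- **`N(u) = red(ϖ⁻¹(u − 1))` IS NILPOTENT** on ROW 0 (`u = g⁻¹γg ∈ GL_N(𝒪)`, `rank(red u − 1) = 0`, `γ` normalised `v`-deep): `χ_{ϖ⁻¹(u−1)} = χ_{ϖ⁻¹(γ−1)} ≡ T^N (ϖ)`.
[cite: Kottwitz1986, §3] [cite: Rogawski1990, §4.9 p. 55] -/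
theorem redMat_inv_smul_sub_one_pow_eq_zero_of_vDeep {ϖ : K} (hϖ : Valued.v ϖ = WithZero.exp (-1 : ℤ)) {γ g : GL (Fin N) K}
    (hdeep : ∀ a b, Valued.v (ϖ⁻¹ * (ϖ⁻¹ * ((γ : Matrix (Fin N) (Fin N) K) - 1) a b)) ≤ 1) (hu : g⁻¹ * γ * g ∈ glInt N K)
    (hr0 : (redMat (((g⁻¹ * γ * g : GL (Fin N) K)) : Matrix (Fin N) (Fin N) K) - 1).rank = 0) :
    (redMat (ϖ⁻¹ • ((((g⁻¹ * γ * g : GL (Fin N) K)) : Matrix (Fin N) (Fin N) K) - 1))) ^ N = 0 := by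
  have hϖ1 : Valued.v ϖ < 1 := by rw [hϖ, ← WithZero.exp_zero]; exact WithZero.exp_lt_exp.2 (by norm_num)
  have hNint := valBound_inv_smul_sub_one_of_rank_eq_zero hϖ hu hr0
  have hWv : ∀ a b, Valued.v ((ϖ⁻¹ • ((γ : Matrix (Fin N) (Fin N) K) - 1)) a b) < 1 := fun a b => ((v_sub_one_le_of_vDeep hϖ hdeep a b).1).trans_lt hϖ1
  have hW : ValBound 1 (ϖ⁻¹ • ((γ : Matrix (Fin N) (Fin N) K) - 1)) := fun a b => by
    have h := (v_le_one_iff_valuation_le_one _).1 (hWv a b).le; exact h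
  have hWlt : ∀ a b, valuation K ((ϖ⁻¹ • ((γ : Matrix (Fin N) (Fin N) K) - 1)) a b) < 1 := fun a b => (v_lt_one_iff_valuation_lt_one _).1 (hWv a b)
  have hchar : (ϖ⁻¹ • ((((g⁻¹ * γ * g : GL (Fin N) K)) : Matrix (Fin N) (Fin N) K) - 1)).charpoly = (ϖ⁻¹ • ((γ : Matrix (Fin N) (Fin N) K) - 1)).charpoly := by
    rw [inv_smul_units_coe_inv_mul_mul_sub_one_eq_conj]; exact Matrix.charpoly_units_conj' g _
  exact pow_card_redMat_eq_zero_of_charpoly_eq hNint hW hWlt hchar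

omit [Valued K ℤᵐ⁰] [ValuativeRel K] [(Valued.v : Valuation K ℤᵐ⁰).Compatible] in
/-- **RANKS OF A NILPOTENT `3 × 3` MATRIX** over a field: `rank n = 2 ⟺ n² ≠ 0` (★ p846931: `n² = 0 ⇒ rank ≤ 1`, `rank ≤ 1 ∧ nilpotent ⇒ n² = 0`; nilpotent ⇒ `rank < 3`).
[cite: Rogawski1990, §4.9 p. 55] -/
theorem rank_eq_two_iff_mul_self_ne_zero_of_pow_eq_zero {k : Type*} [Field k] {n : Matrix (Fin 3) (Fin 3) k} {m : ℕ} (hn : n ^ m = 0) :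
    n.rank = 2 ↔ n * n ≠ 0 := by
  have hlt : n.rank < 3 := rank_lt_of_isNilpotent ⟨m, hn⟩ (by norm_num)
  constructor
  · intro h2 hsq
    have h1 := rank_le_one_of_mul_self_eq_zero hsq
    omega
  · intro hne
    by_contra h2
    exact hne (mul_self_eq_zero_of_rank_le_one_of_isNilpotent (by omega) ⟨m, hn⟩)

omit [Valued K ℤᵐ⁰] [ValuativeRel K] [(Valued.v : Valuation K ℤᵐ⁰).Compatible] in
/-- **RANKS OF A NILPOTENT `3 × 3` MATRIX**: `rank n = 1 ⟺ n² = 0 ∧ n ≠ 0`. [cite: Rogawski1990, §4.9 p. 55] -/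
theorem rank_eq_one_iff_mul_self_eq_zero_and_ne_zero_of_pow_eq_zero {k : Type*} [Field k] {n : Matrix (Fin 3) (Fin 3) k} {m : ℕ} (hn : n ^ m = 0) :
    n.rank = 1 ↔ n * n = 0 ∧ n ≠ 0 := by
  constructor
  · intro h1
    refine ⟨mul_self_eq_zero_of_rank_le_one_of_isNilpotent h1.le ⟨m, hn⟩, fun h0 => ?_⟩
    rw [h0, Matrix.rank_zero] at h1
    exact zero_ne_one h1
  · rintro ⟨hsq, hne⟩
    have h1 := rank_le_one_of_mul_self_eq_zero hsq
    have h0 : n.rank ≠ 0 := fun h0 => hne ((rank_eq_zero_iff_eq_zero n).1 h0)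
    omega

end Literature.NumberTheory.Automorphic.UnitaryLatticeTree

end
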